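import Literature.RepresentationTheory.KonnoKonno2007.JunctionHyperbolicDerivative
import Literature.Analysis.SegalBargmann.SchwartzBargmannIntertwining
import Literature.Analysis.SegalBargmann.HermiteSchwartz
import Literature.Analysis.SegalBargmann.FockOneParameter
import HarnessLib

/-!
# The Hermite / Fock matrix of the hyperbolic generator of a real unitary dual pair

Topic `RepresentationTheory/KonnoKonno2007`; namespace `Literature.RepresentationTheory.KonnoKonno2007.RealDualPair`.
Continuation of `JunctionHyperbolicDerivative` (the generator `hypOpGen = μ₀(u)⁻¹ ∘ hypLeviGen ∘ μ₀(u)` of the hyperbolic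
family `hypOp`, `hypLeviGen f = −(|R|+|S|) f − Σ_{k ∈ plane} x_k ∂_k f`).  Here the generator is computed ON THE HERMITE
SPAN and ON FOCK POLYNOMIALS, i.e. its matrix in the Hermite basis is made explicit (Folland 1989, §1.7 (1.73)–(1.82):
the Bargmann dictionary `Z_j^* B⁻¹ = B⁻¹ z_j`, `π Z_j B⁻¹ = B⁻¹ ∂_j`):

* §1 (generic) derivative of a Hermite-span function on the carrier `σ → ℝ`:
  `D(hermiteSchwartzPi p)(x)[v] = hermiteFun (dirSymb v p) x` (`fderiv_hermiteSchwartzPi_apply`).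
* §2 (generic) THE BARGMANN DICTIONARY for first-order operators (polynomial algebra over the tree's `binv`,
  `X_mul_binv`, `opZ_binv`): `pderiv j (binv F) = 2 binv (∂_j F)` (`pderiv_binv`),
  `opDel j (binv F) = binv (∂_j F − π z_j F)` (`opDel_binv`), and `x_j ∂_j` on `B⁻¹F`:
  `X j * opDel j (binv F) = binv ((2π)⁻¹ ∂_j² F − ½ F − (π/2) z_j² F)` (`X_mul_opDel_binv`).
* §3 (generic) SUBSTITUTION CALCULUS: `linSubst M (linSubst N F) = linSubst (N * M) F` (`linSubst_linSubst`),
  `linSubst U (linSubst U* F) = F` (`linSubst_linSubst_star`), and, with the tree's chain rule `pderiv_linSubst`,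
  `linSubst U (∂_k² (linSubst U* F)) = Σ_b conj(U_{kb}) Σ_a conj(U_{ka}) ∂_a∂_b F` (`linSubst_pderiv_pderiv_linSubst_star`).
* §4 THE SYMBOL: `hypLeviGen (hermiteSchwartzPi p) = hermiteSchwartzPi (hypLeviSymb p)` with
  `hypLeviSymb p = hypWt • p − Σ_k planeInd k • x_k (∂_k − 2π x_k) p` (`hypLeviGen_hermiteSchwartzPi`).
* §5 THE FOCK SIDE: **`hypLeviSymb (binv F) = binv (hypFockSymb F)`**,
  `hypFockSymb F = Σ_{k ∈ plane} ((π/2) z_k² F − (2π)⁻¹ ∂_k² F)` (`hypLeviSymb_binv`): in Folland's letters the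
  hyperbolic Levi generator is `(π/2) Σ_{k ∈ plane} (Z_k^{*2} − Z_k²)` — no number-operator part.
* §6 ON SCHWARTZ FUNCTIONS: `hypLeviGen (binvPi F) = binvPi (hypFockSymb F)` (`hypLeviGen_binvPi`) and, through the
  Siegel frame `u = frameU` and the tree's intertwining `μ₀(U) B⁻¹F = B⁻¹(F ∘ U⁻¹)` (`unitaryOpPi_binvPi`),
  **`hypOpGen (binvPi F) = binvPi (linSubst u (hypFockSymb (linSubst u* F)))`** (`hypOpGen_binvPi`), with the slope
  form `tendsto_hypOp_binvPi_sub_div_ofReal`.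
* §7 THE CONJUGATE IN CLOSED FORM: for any unitary `U`,
  `linSubst U (hypFockSymb (linSubst U* F)) = Σ_k planeInd k • ((π/2) ℓ_k² F − (2π)⁻¹ Σ_b conj(U_{kb}) Σ_a conj(U_{ka}) ∂_a∂_b F)`,
  `ℓ_k = linForm U k = Σ_a U_{ka} z_a` (`linSubst_hypFockSymb_linSubst_star`), whence THE EXPLICIT FOCK MATRIX of
  `hypOpGen` (`hypOpGen_binvPi_eq`): a quadratic creation part `(π/2) Σ_{k ∈ plane} ℓ_k(z)²` plus a quadratic
  annihilation part `−(2π)⁻¹ Σ_{k ∈ plane} ℓ̄_k(∂)²`, the signature of a split (hyperbolic) torus.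
* §8 THE FRAME ROWS EVALUATED: writing the §7 summand as `quadRow U k F` (§3b, generic two-entry-row calculus
  `linForm_of_row_eq`, `sum_star_row_smul`) and reading the rows of the Siegel frame (`frame_row_PR/QR/QS/PS`),
  each hyperbolic plane contributes the printed shape `(i/λ) P + iλ Δ`, `P = z_k z_{k'}`, `Δ = ∂_k ∂_{k'}`
  (`hypPairSymb k k' F = π z_k z_{k'} F + π⁻¹ ∂_k∂_{k'} F`): `quadRow_frame_R` (`λ = −π⁻¹`, planes `(p₀,r) | (q₀,r)`),
  `quadRow_frame_S` (`λ = +π⁻¹`, planes `(p₀,s) | (q₀,s)`), whence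
  **`linSubst u (hypFockSymb (linSubst u* F)) = i (Σ_s hypPairSymb − Σ_r hypPairSymb) F`** (`linSubst_hypFockSymb_frame`),
  **`hypOpGen (B⁻¹F) = B⁻¹ (i (Σ_s … − Σ_r …) F)`** (`hypOpGen_binvPi_frame`) and the explicit slopes
  `tendsto_hypOp_binvPi_sub_div_frame`, `tendsto_hypOp_binvPi_sub_hypOp_zero_div_frame` (difference quotient of
  `t ↦ hypOp t` at `0`, with `hypOp 0` visible), `tendsto_hypOp_binvPi_sub_hypOp_zero_div_ofReal`.

The generic facts (§1–§3b: Hermite span, Bargmann dictionary, substitution calculus, two-entry rows) are stated in the namespace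
`Literature.Analysis.SegalBargmann` of the files they extend; the junction-specific ones (§4–§8) in
`Literature.RepresentationTheory.KonnoKonno2007.RealDualPair`.

Everything is proved from Mathlib and the imported tree files; no cited fact is used as a hypothesis; 0 records.

## References

* G. B. Folland, *Harmonic Analysis in Phase Space*, Annals of Mathematics Studies 122, Princeton UP (1989): §1.7
  (1.73)–(1.78) (Bargmann dictionary), (1.80) (commutation relations), (1.82) (the Hermite ladder); Ch. 4 (4.24),
  Prop. (4.39), Prop. (4.49) (quadratic symbols of the metaplectic Lie algebra on the Hermite span).
  [cite: Folland1989, §1.7]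

## Provenance

Written for the tree under the LEAN-IN-TREE rule by the pub-hodgecm formalisation cell (model-construction sub-cell,
theta-kernel lane mc-theta-1), over `JunctionHyperbolicDerivative`, `SchwartzBargmannIntertwining`, `FockHermite`,
`HermiteSchwartz`.  Nothing here is specific to that cell.
-/

set_option autoImplicit false

noncomputable section

open Matrix Complex MeasureTheory Filter MvPolynomial
open scoped Topology Real BigOperators
open Literature.Analysis.SegalBargmann Literature.Analysis.Distribution

local notation "SR" σ => SchwartzMap (σ → ℝ) ℂ

namespace Literature.Analysis.SegalBargmann

/-! ## §1  Derivative of a Hermite-span function on the carrier `σ → ℝ` (generic) -/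

section SpanDeriv

variable {σ : Type*} [Fintype σ]

/-- as functions, `hermiteSchwartzPi p = hermiteFun p`. [folklore] -/
theorem coe_hermiteSchwartzPi (p : MvPolynomial σ ℂ) : (⇑(hermiteSchwartzPi p : SR σ)) = hermiteFun p :=
  funext (hermiteSchwartzPi_apply p)

variable [DecidableEq σ]

/-- **`D(p e^{−π|·|²})(x)[v] = (dirSymb v p) e^{−π|·|²} (x)`** for the Hermite-span Schwartz function on `σ → ℝ`.
[cite: Folland1989, §1.7] -/
theorem fderiv_hermiteSchwartzPi_apply (p : MvPolynomial σ ℂ) (x v : σ → ℝ) :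
    fderiv ℝ (⇑(hermiteSchwartzPi p : SR σ)) x v = hermiteFun (dirSymb v p) x := by
  rw [coe_hermiteSchwartzPi, fderiv_hermiteFun_apply]

end SpanDeriv

/-! ## §2  The Bargmann dictionary for `∂_j`, `x_j ∂_j` (generic) -/

section Bargmann

variable {σ : Type*} [Fintype σ] [DecidableEq σ]

/-- **`∂_j` of a `B⁻¹`-symbol**: `pderiv j (binv F) = 2 binv (∂_j F)` (from `π Z_j B⁻¹ = B⁻¹ ∂_j` and
`Z_j = (2π)⁻¹ ∂_j` on symbols). [cite: Folland1989, §1.7] -/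
theorem pderiv_binv (j : σ) (F : MvPolynomial σ ℂ) : pderiv j (binv F) = (2 : ℂ) • binv (pderiv j F) := by
  have h := opZ_binv j F
  rw [opZ_apply] at h
  have h2 : pderiv j (binv F) = (2 * π : ℂ) • ((2 * π : ℂ)⁻¹ • pderiv j (binv F)) := by
    rw [smul_smul, mul_inv_cancel₀ two_pi_ne_zero, one_smul]
  rw [h2, h, smul_smul]
  congr 1
  field_simp

/-- **the symbol of `∂/∂x_j` on `B⁻¹F`**: `opDel j (binv F) = binv (∂_j F − π z_j F)`. [cite: Folland1989, §1.7] -/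
theorem opDel_binv (j : σ) (F : MvPolynomial σ ℂ) :
    opDel j (binv F) = binv (pderiv j F - (π : ℂ) • (X j * F)) := by
  have hπ : (π : ℂ)⁻¹ * π = 1 := inv_mul_cancel₀ (Complex.ofReal_ne_zero.mpr Real.pi_ne_zero)
  rw [opDel_apply, pderiv_binv, X_mul_binv, map_sub, map_smul]
  simp only [smul_add, smul_smul]
  match_scalars <;> first | ring1 | (linear_combination (-1 : ℂ) * hπ)

/-- **`x_j ∂_j` on `B⁻¹F` in Fock letters**: `X j * opDel j (binv F) = binv ((2π)⁻¹ ∂_j² F − ½ F − (π/2) z_j² F)`.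
[cite: Folland1989, §1.7] -/
theorem X_mul_opDel_binv (j : σ) (F : MvPolynomial σ ℂ) :
    X j * opDel j (binv F) =
      binv ((2 * π : ℂ)⁻¹ • pderiv j (pderiv j F) - (1 / 2 : ℂ) • F - ((π : ℂ) / 2) • (X j * (X j * F))) := by
  have hπ : (π : ℂ)⁻¹ * π = 1 := inv_mul_cancel₀ (Complex.ofReal_ne_zero.mpr Real.pi_ne_zero)
  rw [opDel_binv, X_mul_binv]
  rw [show pderiv j (pderiv j F - (π : ℂ) • (X j * F)) = pderiv j (pderiv j F) - (π : ℂ) • (X j * pderiv j F + F) by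
    rw [map_sub, Derivation.map_smul, pderiv_X_mul, if_pos rfl]]
  simp only [mul_sub, mul_smul_comm, map_sub, map_add, map_smul, smul_sub, smul_add, smul_smul]
  match_scalars <;>
    first | ring1 | (linear_combination (-(1 / 2 : ℂ)) * hπ)

end Bargmann

/-! ## §3  Substitution calculus (generic) -/

section LinSubst

variable {σ : Type*} [Fintype σ] [DecidableEq σ]

omit [DecidableEq σ] in
/-- **composition of linear substitutions**: `linSubst M (linSubst N F) = linSubst (N * M) F`
(`z ↦ F(N(Mz))`; `linSubst M F = F(Mz)`). [folklore] -/
theorem linSubst_linSubst (M N : Matrix σ σ ℂ) (F : MvPolynomial σ ℂ) :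
    linSubst M (linSubst N F) = linSubst (N * M) F := by
  have h : (linSubst M).comp (linSubst N) = linSubst (N * M) :=
    MvPolynomial.algHom_ext fun k => by
      rw [AlgHom.comp_apply, linSubst_X, linSubst_X, map_sum]
      simp only [map_mul, linSubst_C, linSubst_X, Finset.mul_sum, Matrix.mul_apply, map_sum, Finset.sum_mul,
        mul_assoc]
      rw [Finset.sum_comm]
  rw [← AlgHom.comp_apply, h]

/-- `linSubst U (linSubst U* F) = F` for a unitary matrix `U`. [folklore] -/
theorem linSubst_linSubst_star (U : Matrix.unitaryGroup σ ℂ) (F : MvPolynomial σ ℂ) :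
    linSubst (U : Matrix σ σ ℂ) (linSubst (star (U : Matrix σ σ ℂ)) F) = F := by
  rw [linSubst_linSubst, Matrix.UnitaryGroup.star_mul_self, linSubst_one_apply]

/-- **second derivatives through a unitary conjugation**:
`linSubst U (∂_k² (linSubst U* F)) = Σ_b conj(U_{kb}) • Σ_a conj(U_{ka}) • ∂_a ∂_b F`. [folklore] -/
theorem linSubst_pderiv_pderiv_linSubst_star (U : Matrix.unitaryGroup σ ℂ) (k : σ) (F : MvPolynomial σ ℂ) :
    linSubst (U : Matrix σ σ ℂ) (pderiv k (pderiv k (linSubst (star (U : Matrix σ σ ℂ)) F))) =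
      ∑ b, star ((U : Matrix σ σ ℂ) k b) • ∑ a, star ((U : Matrix σ σ ℂ) k a) • pderiv a (pderiv b F) := by
  rw [pderiv_linSubst, map_sum, map_sum]
  refine Finset.sum_congr rfl fun b _ => ?_
  rw [Derivation.map_smul, map_smul, pderiv_linSubst, map_sum, Matrix.star_apply]
  refine congr_arg _ (Finset.sum_congr rfl fun a _ => ?_)
  rw [map_smul, linSubst_linSubst_star, Matrix.star_apply]

/-- `star (u⁻¹) = u` for a unitary matrix (bookkeeping). [folklore] -/
theorem star_coe_inv_unitary (U : Matrix.unitaryGroup σ ℂ) :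
    star ((U⁻¹ : Matrix.unitaryGroup σ ℂ) : Matrix σ σ ℂ) = (U : Matrix σ σ ℂ) := by
  rw [Matrix.UnitaryGroup.inv_val, star_star]

end LinSubst

/-! ## §3b  Rows with two entries (generic) -/

section Rows

variable {σ : Type*} [Fintype σ] [DecidableEq σ]

/-- **the row symbol** of a unitary conjugation of the plane symbol `(π/2) z_k² − (2π)⁻¹ ∂_k²`:
`quadRow U k F = (π/2) ℓ_k (ℓ_k F) − (2π)⁻¹ Σ_b conj(U_{kb}) Σ_a conj(U_{ka}) ∂_a ∂_b F`, `ℓ_k = linForm U k = Σ_a U_{ka} z_a`.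
[folklore] -/
def quadRow (U : Matrix σ σ ℂ) (k : σ) (F : MvPolynomial σ ℂ) : MvPolynomial σ ℂ :=
  ((π : ℂ) / 2) • (linForm U k * (linForm U k * F)) -
    (2 * π : ℂ)⁻¹ • ∑ b, star (U k b) • ∑ a, star (U k a) • pderiv a (pderiv b F)

/-- a row with (at most) two entries: its linear form `ℓ_k = c₁ z_{k₁} + c₂ z_{k₂}`. [folklore] -/
theorem linForm_of_row_eq {B : Matrix σ σ ℂ} {k k₁ k₂ : σ} {c₁ c₂ : ℂ}
    (h : ∀ a, B k a = (if a = k₁ then c₁ else 0) + (if a = k₂ then c₂ else 0)) :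
    linForm B k = C c₁ * X k₁ + C c₂ * X k₂ := by
  have h' : ∀ a, C (B k a) * X a = (if a = k₁ then C c₁ * X a else 0) + (if a = k₂ then C c₂ * X a else 0) := by
    intro a
    rw [h]
    split_ifs <;> simp [map_add, add_mul]
  rw [linForm, Finset.sum_congr rfl fun a _ => h' a, Finset.sum_add_distrib, Finset.sum_ite_eq',
    Finset.sum_ite_eq']
  simp

/-- a row with (at most) two entries: the conjugate-weighted sum over it. [folklore] -/
theorem sum_star_row_smul {M : Type*} [AddCommMonoid M] [Module ℂ M] {B : Matrix σ σ ℂ}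
    {k k₁ k₂ : σ} {c₁ c₂ : ℂ}
    (h : ∀ a, B k a = (if a = k₁ then c₁ else 0) + (if a = k₂ then c₂ else 0)) (G : σ → M) :
    ∑ b, star (B k b) • G b = star c₁ • G k₁ + star c₂ • G k₂ := by
  have h' : ∀ b, star (B k b) • G b =
      (if b = k₁ then star c₁ • G b else 0) + (if b = k₂ then star c₂ • G b else 0) := by
    intro b
    rw [h]
    split_ifs <;> simp [star_add, add_smul]
  rw [Finset.sum_congr rfl fun b _ => h' b, Finset.sum_add_distrib, Finset.sum_ite_eq', Finset.sum_ite_eq']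
  simp

omit [Fintype σ] [DecidableEq σ] in
/-- a real indicator cast to `ℂ`, as a scalar. [folklore] -/
theorem ofReal_ite_one_zero_smul {M : Type*} [AddCommMonoid M] [Module ℂ M] (c : Prop) [Decidable c] (v : M) :
    (((if c then (1 : ℝ) else 0 : ℝ)) : ℂ) • v = if c then v else 0 := by
  split_ifs <;> simp

end Rows

end Literature.Analysis.SegalBargmann

namespace Literature.RepresentationTheory.KonnoKonno2007

namespace RealDualPair

/-! ## §4  The symbol of `hypLeviGen` on the Hermite span -/

section Symbol

variable {P Q : Type*} [Fintype P] [DecidableEq P] [Fintype Q] [DecidableEq Q]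
  (R S : Type*) [Fintype R] [DecidableEq R] [Fintype S] [DecidableEq S] (p₀ : P) (q₀ : Q)

/-- **The symbol of the hyperbolic Levi generator** on `p(x) e^{−π|x|²}`:
`hypLeviSymb p = hypWt • p − Σ_k planeInd k • x_k (∂_k p − 2π x_k p)`. [cite: Folland1989, (4.24)] -/
def hypLeviSymb : MvPolynomial (DPIdx P Q R S) ℂ →ₗ[ℂ] MvPolynomial (DPIdx P Q R S) ℂ :=
  ((hypWt R S : ℝ) : ℂ) • LinearMap.id -
    ∑ k, ((planeInd R S p₀ q₀ k : ℝ) : ℂ) • ((opX k).comp (opDel k))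

omit [DecidableEq R] [DecidableEq S] in
/-- unfolding `hypLeviSymb`. [folklore] -/
theorem hypLeviSymb_apply (p : MvPolynomial (DPIdx P Q R S) ℂ) :
    hypLeviSymb R S p₀ q₀ p =
      ((hypWt R S : ℝ) : ℂ) • p - ∑ k, ((planeInd R S p₀ q₀ k : ℝ) : ℂ) • (X k * opDel k p) := by
  simp only [hypLeviSymb, LinearMap.sub_apply, LinearMap.smul_apply, LinearMap.id_coe, id_eq,
    LinearMap.coe_sum, Finset.sum_apply, LinearMap.comp_apply, opX_apply]

/-- **`hypLeviGen` preserves the Hermite span, with symbol `hypLeviSymb`**: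
`hypLeviGen (hermiteSchwartzPi p) = hermiteSchwartzPi (hypLeviSymb p)`. [cite: Folland1989, (4.24)] -/
theorem hypLeviGen_hermiteSchwartzPi (p : MvPolynomial (DPIdx P Q R S) ℂ) :
    hypLeviGen R S p₀ q₀ (hermiteSchwartzPi p) = hermiteSchwartzPi (hypLeviSymb R S p₀ q₀ p) := by
  ext x
  rw [hypLeviGen_apply, fderiv_hermiteSchwartzPi_apply, hermiteSchwartzPi_apply, hermiteSchwartzPi_apply,
    hypLeviSymb_apply, hermiteFun_sub, hermiteFun_smul, hermiteFun_sum, dirSymb, hermiteFun_sum]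
  congr 1
  refine Finset.sum_congr rfl fun k _ => ?_
  rw [hermiteFun_smul, hermiteFun_smul, hermiteFun_X_mul, planeProj_apply, Complex.ofReal_mul]
  ring

end Symbol

/-! ## §5  The Fock side: `hypLeviSymb ∘ binv = binv ∘ hypFockSymb` -/

section FockSymbol

variable {P Q : Type*} [Fintype P] [DecidableEq P] [Fintype Q] [DecidableEq Q]
  (R S : Type*) [Fintype R] [DecidableEq R] [Fintype S] [DecidableEq S] (p₀ : P) (q₀ : Q)

/-- **The Fock symbol of the hyperbolic Levi generator**:
`hypFockSymb F = Σ_k planeInd k • ((π/2) z_k² F − (2π)⁻¹ ∂_k² F)` — in Folland's letters `(π/2) Σ_{k ∈ plane} (Z_k^{*2} − Z_k²)`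
read through `B⁻¹`. [cite: Folland1989, §1.7] -/
def hypFockSymb : MvPolynomial (DPIdx P Q R S) ℂ →ₗ[ℂ] MvPolynomial (DPIdx P Q R S) ℂ :=
  ∑ k, ((planeInd R S p₀ q₀ k : ℝ) : ℂ) •
    ((((π : ℂ) / 2) • (opX k).comp (opX k)) - (2 * π : ℂ)⁻¹ • (opPd k).comp (opPd k))

omit [DecidableEq R] [DecidableEq S] in
/-- unfolding `hypFockSymb`. [folklore] -/
theorem hypFockSymb_apply (F : MvPolynomial (DPIdx P Q R S) ℂ) :
    hypFockSymb R S p₀ q₀ F =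
      ∑ k, ((planeInd R S p₀ q₀ k : ℝ) : ℂ) •
        (((π : ℂ) / 2) • (X k * (X k * F)) - (2 * π : ℂ)⁻¹ • pderiv k (pderiv k F)) := by
  simp only [hypFockSymb, LinearMap.coe_sum, Finset.sum_apply, LinearMap.smul_apply, LinearMap.sub_apply,
    LinearMap.comp_apply, opX_apply, opPd_apply]

omit [DecidableEq R] [DecidableEq S] in
/-- the weight as a multiple of the plane count: `hypWt = −½ Σ_k planeInd k` (in `ℂ`). [folklore] -/
theorem hypWt_eq_sum : ((hypWt R S : ℝ) : ℂ) = ∑ k, (-(1 / 2 : ℂ)) * ((planeInd R S p₀ q₀ k : ℝ) : ℂ) := by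
  rw [← Finset.mul_sum, ← Complex.ofReal_sum, sum_planeInd, hypWt]
  push_cast
  ring

/-- **THE BARGMANN SIDE OF THE HYPERBOLIC GENERATOR**: `hypLeviSymb (binv F) = binv (hypFockSymb F)`.
[cite: Folland1989, §1.7] -/
theorem hypLeviSymb_binv (F : MvPolynomial (DPIdx P Q R S) ℂ) :
    hypLeviSymb R S p₀ q₀ (binv F) = binv (hypFockSymb R S p₀ q₀ F) := by
  rw [hypLeviSymb_apply, hypFockSymb_apply, hypWt_eq_sum R S p₀ q₀, Finset.sum_smul, ← Finset.sum_sub_distrib, map_sum]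
  refine Finset.sum_congr rfl fun k _ => ?_
  rw [X_mul_opDel_binv]
  simp only [map_sub, map_smul]
  module

end FockSymbol

/-! ## §6  On Schwartz functions: `hypLeviGen (B⁻¹F)` and `hypOpGen (B⁻¹F)` -/

section Schwartz

variable {P Q : Type*} [Fintype P] [DecidableEq P] [Fintype Q] [DecidableEq Q]
  (R S : Type*) [Fintype R] [DecidableEq R] [Fintype S] [DecidableEq S] (p₀ : P) (q₀ : Q)

/-- **`hypLeviGen (B⁻¹F) = B⁻¹ (hypFockSymb F)`** on `𝓢(ℝ^{DPIdx})`. [cite: Folland1989, §1.7] -/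
theorem hypLeviGen_binvPi (F : MvPolynomial (DPIdx P Q R S) ℂ) :
    hypLeviGen R S p₀ q₀ (binvPi F) = binvPi (hypFockSymb R S p₀ q₀ F) := by
  rw [binvPi_def, hypLeviGen_hermiteSchwartzPi, hypLeviSymb_binv, ← binvPi_def]

/-- **THE FOCK MATRIX OF THE GENERATOR OF `hypOp`**: through the Siegel frame `u = frameU`,
`hypOpGen (B⁻¹F) = B⁻¹ (linSubst u (hypFockSymb (linSubst u* F)))` — the `u`-conjugate of the diagonal quadratic symbol.
[cite: Folland1989, Prop (4.39)] -/
theorem hypOpGen_binvPi (F : MvPolynomial (DPIdx P Q R S) ℂ) :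
    hypOpGen R S p₀ q₀ (binvPi F) =
      binvPi (linSubst ((frameU R S p₀ q₀ : Matrix.unitaryGroup (DPIdx P Q R S) ℂ) : Matrix _ _ ℂ)
        (hypFockSymb R S p₀ q₀
          (linSubst (star ((frameU R S p₀ q₀ : Matrix.unitaryGroup (DPIdx P Q R S) ℂ) : Matrix _ _ ℂ)) F))) := by
  rw [hypOpGen_apply, unitaryOpPi_binvPi, hypLeviGen_binvPi, unitaryOpPi_binvPi, star_coe_inv_unitary]

/-- **The slope of `hypOp` on a Fock polynomial, in Fock letters** (complex scalars):
`((t:ℝ):ℂ)⁻¹ • (hypOp t (B⁻¹F) − B⁻¹F) ⟶ B⁻¹ (linSubst u (hypFockSymb (linSubst u* F)))`. [cite: Folland1989, Prop (4.39)] -/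
theorem tendsto_hypOp_binvPi_sub_div_ofReal (F : MvPolynomial (DPIdx P Q R S) ℂ) :
    Tendsto (fun t : ℝ => ((t : ℝ) : ℂ)⁻¹ • (hypOp R S p₀ q₀ t (binvPi F) - binvPi F)) (𝓝[≠] 0)
      (𝓝 (binvPi (linSubst ((frameU R S p₀ q₀ : Matrix.unitaryGroup (DPIdx P Q R S) ℂ) : Matrix _ _ ℂ)
        (hypFockSymb R S p₀ q₀
          (linSubst (star ((frameU R S p₀ q₀ : Matrix.unitaryGroup (DPIdx P Q R S) ℂ) : Matrix _ _ ℂ)) F))))) := by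
  rw [← hypOpGen_binvPi]
  exact tendsto_hypOp_sub_div_ofReal R S p₀ q₀ (binvPi F)

/-! ## §7  The conjugated symbol in closed form -/

/-- **closed form of the conjugated Fock symbol**: for any unitary `U`,
`linSubst U (hypFockSymb (linSubst U* F)) = Σ_k planeInd k • ((π/2) ℓ_k (ℓ_k F) − (2π)⁻¹ Σ_b conj(U_{kb}) Σ_a conj(U_{ka}) ∂_a∂_b F)`
with `ℓ_k = linForm U k = Σ_a U_{ka} z_a`. [cite: Folland1989, Prop (4.39)] -/
theorem linSubst_hypFockSymb_linSubst_star (U : Matrix.unitaryGroup (DPIdx P Q R S) ℂ)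
    (F : MvPolynomial (DPIdx P Q R S) ℂ) :
    linSubst (U : Matrix _ _ ℂ) (hypFockSymb R S p₀ q₀ (linSubst (star (U : Matrix _ _ ℂ)) F)) =
      ∑ k, ((planeInd R S p₀ q₀ k : ℝ) : ℂ) •
        (((π : ℂ) / 2) • (linForm (U : Matrix _ _ ℂ) k * (linForm (U : Matrix _ _ ℂ) k * F)) -
          (2 * π : ℂ)⁻¹ • ∑ b, star ((U : Matrix _ _ ℂ) k b) • ∑ a, star ((U : Matrix _ _ ℂ) k a) •
            pderiv a (pderiv b F)) := by
  rw [hypFockSymb_apply, map_sum]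
  refine Finset.sum_congr rfl fun k _ => ?_
  rw [map_smul, map_sub, map_smul, map_smul, map_mul, map_mul, linSubst_X_eq_linForm, linSubst_linSubst_star,
    linSubst_pderiv_pderiv_linSubst_star]

/-- **THE FOCK MATRIX OF `hypOpGen`, EXPLICITLY**: with `u = frameU` and `ℓ_k = Σ_a u_{ka} z_a`,
`hypOpGen (B⁻¹F) = B⁻¹ (Σ_k planeInd k • ((π/2) ℓ_k² F − (2π)⁻¹ Σ_{a,b} ū_{kb} ū_{ka} ∂_a∂_b F))` — a quadratic creation
part plus a quadratic annihilation part and no number-operator part. [cite: Folland1989, Prop (4.39)] -/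
theorem hypOpGen_binvPi_eq (F : MvPolynomial (DPIdx P Q R S) ℂ) :
    hypOpGen R S p₀ q₀ (binvPi F) =
      binvPi (∑ k, ((planeInd R S p₀ q₀ k : ℝ) : ℂ) •
        (((π : ℂ) / 2) • (linForm (frameU R S p₀ q₀ : Matrix _ _ ℂ) k * (linForm (frameU R S p₀ q₀ : Matrix _ _ ℂ) k * F)) -
          (2 * π : ℂ)⁻¹ • ∑ b, star ((frameU R S p₀ q₀ : Matrix _ _ ℂ) k b) •
            ∑ a, star ((frameU R S p₀ q₀ : Matrix _ _ ℂ) k a) • pderiv a (pderiv b F))) := by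
  rw [hypOpGen_binvPi, linSubst_hypFockSymb_linSubst_star]

/-! ## §8  The frame rows evaluated: the printed shape `(i/λ) P + iλ Δ` per hyperbolic plane -/

/-- §7 in the letters of `quadRow`. [cite: Folland1989, Prop (4.39)] -/
theorem linSubst_hypFockSymb_linSubst_star_eq_sum_quadRow (U : Matrix.unitaryGroup (DPIdx P Q R S) ℂ)
    (F : MvPolynomial (DPIdx P Q R S) ℂ) :
    linSubst (U : Matrix _ _ ℂ) (hypFockSymb R S p₀ q₀ (linSubst (star (U : Matrix _ _ ℂ)) F)) =
      ∑ k, ((planeInd R S p₀ q₀ k : ℝ) : ℂ) • quadRow (U : Matrix _ _ ℂ) k F := by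
  rw [linSubst_hypFockSymb_linSubst_star]
  rfl

/-- **the PAIR SYMBOL of a hyperbolic plane** spanned by the coordinates `k, k'`:
`hypPairSymb k k' F = π z_k z_{k'} F + π⁻¹ ∂_k ∂_{k'} F` (`P = z_k z_{k'}`, `Δ = ∂_k ∂_{k'}`). [folklore] -/
def hypPairSymb {σ : Type*} (k k' : σ) (F : MvPolynomial σ ℂ) : MvPolynomial σ ℂ :=
  (π : ℂ) • (X k * (X k' * F)) + (π : ℂ)⁻¹ • pderiv k (pderiv k' F)

omit [Fintype P] [Fintype Q] [Fintype R] [Fintype S] in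
/-- row `(p₀, r) ∈ P × R` of the Siegel frame, as a two-entry row. [folklore] -/
theorem frame_row_PR (r : R) (a : DPIdx P Q R S) :
    frame R S p₀ q₀ (Sum.inl (Sum.inl (p₀, r))) a =
      (if a = Sum.inl (Sum.inl (p₀, r)) then (((1 / 2 : ℝ) : ℂ) + ((1 / 2 : ℝ) : ℂ) * I) else 0) +
        (if a = Sum.inr (Sum.inr (q₀, r)) then -(((1 / 2 : ℝ) : ℂ) + ((1 / 2 : ℝ) : ℂ) * I) else 0) := by
  rw [frame_ll, if_pos rfl]
  split_ifs <;> ring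

omit [Fintype P] [Fintype Q] [Fintype R] [Fintype S] in
/-- row `(q₀, r) ∈ Q × R` of the Siegel frame, as a two-entry row. [folklore] -/
theorem frame_row_QR (r : R) (a : DPIdx P Q R S) :
    frame R S p₀ q₀ (Sum.inr (Sum.inr (q₀, r))) a =
      (if a = Sum.inl (Sum.inl (p₀, r)) then (((1 / 2 : ℝ) : ℂ) - ((1 / 2 : ℝ) : ℂ) * I) else 0) +
        (if a = Sum.inr (Sum.inr (q₀, r)) then (((1 / 2 : ℝ) : ℂ) - ((1 / 2 : ℝ) : ℂ) * I) else 0) := by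
  rw [frame_rr, if_pos rfl]
  split_ifs <;> ring

omit [Fintype P] [Fintype Q] [Fintype R] [Fintype S] in
/-- row `(q₀, s) ∈ Q × S` of the Siegel frame, as a two-entry row. [folklore] -/
theorem frame_row_QS (s : S) (a : DPIdx P Q R S) :
    frame R S p₀ q₀ (Sum.inl (Sum.inr (q₀, s))) a =
      (if a = Sum.inr (Sum.inl (p₀, s)) then (((1 / 2 : ℝ) : ℂ) - ((1 / 2 : ℝ) : ℂ) * I) else 0) +
        (if a = Sum.inl (Sum.inr (q₀, s)) then -(((1 / 2 : ℝ) : ℂ) - ((1 / 2 : ℝ) : ℂ) * I) else 0) := by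
  rw [frame_lr, if_pos rfl]
  split_ifs <;> ring

omit [Fintype P] [Fintype Q] [Fintype R] [Fintype S] in
/-- row `(p₀, s) ∈ P × S` of the Siegel frame, as a two-entry row. [folklore] -/
theorem frame_row_PS (s : S) (a : DPIdx P Q R S) :
    frame R S p₀ q₀ (Sum.inr (Sum.inl (p₀, s))) a =
      (if a = Sum.inr (Sum.inl (p₀, s)) then (((1 / 2 : ℝ) : ℂ) + ((1 / 2 : ℝ) : ℂ) * I) else 0) +
        (if a = Sum.inl (Sum.inr (q₀, s)) then (((1 / 2 : ℝ) : ℂ) + ((1 / 2 : ℝ) : ℂ) * I) else 0) := by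
  rw [frame_rl, if_pos rfl]
  split_ifs <;> ring

omit [Fintype P] [DecidableEq P] [Fintype Q] [DecidableEq Q] [Fintype R] [DecidableEq R] [Fintype S]
  [DecidableEq S] in
/-- `conj ((1+i)/2) = (1−i)/2`. [folklore] -/
theorem star_halfPlusI : star ((((1 / 2 : ℝ) : ℂ) + ((1 / 2 : ℝ) : ℂ) * I)) =
    (((1 / 2 : ℝ) : ℂ) - ((1 / 2 : ℝ) : ℂ) * I) := by
  apply Complex.ext <;> simp

omit [Fintype P] [DecidableEq P] [Fintype Q] [DecidableEq Q] [Fintype R] [DecidableEq R] [Fintype S]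
  [DecidableEq S] in
/-- `conj ((1−i)/2) = (1+i)/2`. [folklore] -/
theorem star_halfMinusI : star ((((1 / 2 : ℝ) : ℂ) - ((1 / 2 : ℝ) : ℂ) * I)) =
    (((1 / 2 : ℝ) : ℂ) + ((1 / 2 : ℝ) : ℂ) * I) := by
  apply Complex.ext <;> simp

/-- **an `R`-plane of the frame**: the rows `(p₀,r)` and `(q₀,r)` together contribute
`−i (π z_{(p₀,r)} z_{(q₀,r)} + π⁻¹ ∂_{(p₀,r)} ∂_{(q₀,r)}) F` — the printed `(i/λ) P + iλ Δ` with `λ = −π⁻¹`.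
[cite: Folland1989, Prop (4.39)] -/
theorem quadRow_frame_R (r : R) (F : MvPolynomial (DPIdx P Q R S) ℂ) :
    quadRow (frame R S p₀ q₀) (Sum.inl (Sum.inl (p₀, r))) F +
        quadRow (frame R S p₀ q₀) (Sum.inr (Sum.inr (q₀, r))) F =
      -(I • hypPairSymb (Sum.inl (Sum.inl (p₀, r))) (Sum.inr (Sum.inr (q₀, r))) F) := by
  have h1 := frame_row_PR R S p₀ q₀ r
  have h4 := frame_row_QR R S p₀ q₀ r
  rw [quadRow, quadRow, linForm_of_row_eq h1, linForm_of_row_eq h4, sum_star_row_smul h1, sum_star_row_smul h4,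
    sum_star_row_smul h1, sum_star_row_smul h1, sum_star_row_smul h4, sum_star_row_smul h4, star_neg,
    star_halfPlusI, star_halfMinusI, hypPairSymb,
    pderiv_pderiv_comm (Sum.inr (Sum.inr (q₀, r))) (Sum.inl (Sum.inl (p₀, r))) F]
  simp only [map_neg, add_mul, mul_add, neg_mul, mul_neg, ← smul_eq_C_mul, smul_mul_assoc, mul_smul_comm, smul_smul,
    smul_add, smul_neg, neg_smul, mul_left_comm (X (Sum.inr (Sum.inr (q₀, r)))) (X (Sum.inl (Sum.inl (p₀, r))))]
  push_cast
  match_scalars <;> first | ring1 | (ring_nf; simp only [Complex.I_sq]; ring_nf)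

/-- **an `S`-plane of the frame**: the rows `(q₀,s)` and `(p₀,s)` together contribute
`+i (π z_{(p₀,s)} z_{(q₀,s)} + π⁻¹ ∂_{(p₀,s)} ∂_{(q₀,s)}) F` — the printed `(i/λ) P + iλ Δ` with `λ = +π⁻¹`.
[cite: Folland1989, Prop (4.39)] -/
theorem quadRow_frame_S (s : S) (F : MvPolynomial (DPIdx P Q R S) ℂ) :
    quadRow (frame R S p₀ q₀) (Sum.inl (Sum.inr (q₀, s))) F +
        quadRow (frame R S p₀ q₀) (Sum.inr (Sum.inl (p₀, s))) F =
      I • hypPairSymb (Sum.inr (Sum.inl (p₀, s))) (Sum.inl (Sum.inr (q₀, s))) F := by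
  have h2 := frame_row_QS R S p₀ q₀ s
  have h3 := frame_row_PS R S p₀ q₀ s
  rw [quadRow, quadRow, linForm_of_row_eq h2, linForm_of_row_eq h3, sum_star_row_smul h2, sum_star_row_smul h3,
    sum_star_row_smul h2, sum_star_row_smul h2, sum_star_row_smul h3, sum_star_row_smul h3, star_neg,
    star_halfPlusI, star_halfMinusI, hypPairSymb,
    pderiv_pderiv_comm (Sum.inl (Sum.inr (q₀, s))) (Sum.inr (Sum.inl (p₀, s))) F]
  simp only [map_neg, add_mul, mul_add, neg_mul, mul_neg, ← smul_eq_C_mul, smul_mul_assoc, mul_smul_comm, smul_smul,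
    smul_add, smul_neg, neg_smul, mul_left_comm (X (Sum.inl (Sum.inr (q₀, s)))) (X (Sum.inr (Sum.inl (p₀, s))))]
  push_cast
  match_scalars <;> first | ring1 | (ring_nf; simp only [Complex.I_sq]; ring_nf)

/-- **THE FRAME ROWS SUMMED**:
`Σ_k planeInd k • quadRow u k F = i (Σ_s (π z_{(p₀,s)} z_{(q₀,s)} + π⁻¹ ∂∂) F − Σ_r (π z_{(p₀,r)} z_{(q₀,r)} + π⁻¹ ∂∂) F)`.
[cite: Folland1989, Prop (4.39)] -/
theorem sum_planeInd_smul_quadRow_frame (F : MvPolynomial (DPIdx P Q R S) ℂ) :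
    ∑ k, ((planeInd R S p₀ q₀ k : ℝ) : ℂ) • quadRow (frame R S p₀ q₀) k F =
      I • ((∑ s : S, hypPairSymb (Sum.inr (Sum.inl (p₀, s))) (Sum.inl (Sum.inr (q₀, s))) F) -
        ∑ r : R, hypPairSymb (Sum.inl (Sum.inl (p₀, r))) (Sum.inr (Sum.inr (q₀, r))) F) := by
  simp only [Fintype.sum_sum_type, Fintype.sum_prod_type, planeInd_ll, planeInd_lr, planeInd_rl, planeInd_rr,
    ofReal_ite_one_zero_smul, Finset.sum_ite_irrel, Finset.sum_const_zero, Finset.sum_ite_eq', Finset.mem_univ,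
    if_true]
  have e4 : ∀ a b c d : MvPolynomial (DPIdx P Q R S) ℂ, a + b + (c + d) = (a + d) + (b + c) :=
    fun _ _ _ _ => by abel
  rw [e4, ← Finset.sum_add_distrib, ← Finset.sum_add_distrib]
  simp only [quadRow_frame_R, quadRow_frame_S, Finset.sum_neg_distrib, ← Finset.smul_sum, smul_sub]
  abel

/-- **THE CONJUGATED FOCK SYMBOL THROUGH THE SIEGEL FRAME, EXPLICITLY**:
`linSubst u (hypFockSymb (linSubst u* F)) = i (Σ_{s ∈ S} (π z_{(p₀,s)} z_{(q₀,s)} + π⁻¹ ∂_{(p₀,s)} ∂_{(q₀,s)}) F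
− Σ_{r ∈ R} (π z_{(p₀,r)} z_{(q₀,r)} + π⁻¹ ∂_{(p₀,r)} ∂_{(q₀,r)}) F)` — per hyperbolic plane the printed shape
`(i/λ) P + iλ Δ`, `P = z_k z_{k'}`, `Δ = ∂_k ∂_{k'}`, with `λ = +π⁻¹` on the `S`-planes and `λ = −π⁻¹` on the `R`-planes
(Gaussian `e^{−π|x|²}`). [cite: Folland1989, Prop (4.39)] -/
theorem linSubst_hypFockSymb_frame (F : MvPolynomial (DPIdx P Q R S) ℂ) :
    linSubst (frame R S p₀ q₀) (hypFockSymb R S p₀ q₀ (linSubst (star (frame R S p₀ q₀)) F)) =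
      I • ((∑ s : S, hypPairSymb (Sum.inr (Sum.inl (p₀, s))) (Sum.inl (Sum.inr (q₀, s))) F) -
        ∑ r : R, hypPairSymb (Sum.inl (Sum.inl (p₀, r))) (Sum.inr (Sum.inr (q₀, r))) F) := by
  rw [← sum_planeInd_smul_quadRow_frame, ← coe_frameU, linSubst_hypFockSymb_linSubst_star_eq_sum_quadRow]

/-- **THE FOCK MATRIX OF `hypOpGen` THROUGH THE FRAME**:
`hypOpGen (B⁻¹F) = B⁻¹ (i (Σ_s (π z z' + π⁻¹ ∂∂') F − Σ_r (π z z' + π⁻¹ ∂∂') F))`. [cite: Folland1989, Prop (4.39)] -/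
theorem hypOpGen_binvPi_frame (F : MvPolynomial (DPIdx P Q R S) ℂ) :
    hypOpGen R S p₀ q₀ (binvPi F) =
      binvPi (I • ((∑ s : S, hypPairSymb (Sum.inr (Sum.inl (p₀, s))) (Sum.inl (Sum.inr (q₀, s))) F) -
        ∑ r : R, hypPairSymb (Sum.inl (Sum.inl (p₀, r))) (Sum.inr (Sum.inr (q₀, r))) F)) := by
  rw [hypOpGen_binvPi, coe_frameU, linSubst_hypFockSymb_frame]

/-- **THE SLOPE OF `hypOp` ON A FOCK POLYNOMIAL, EXPLICITLY**:
`((t:ℝ):ℂ)⁻¹ • (hypOp t (B⁻¹F) − B⁻¹F) ⟶ B⁻¹ (i (Σ_s (π z z' + π⁻¹ ∂∂') F − Σ_r (π z z' + π⁻¹ ∂∂') F))` along `𝓝[≠] 0`.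
[cite: Folland1989, Prop (4.39)] -/
theorem tendsto_hypOp_binvPi_sub_div_frame (F : MvPolynomial (DPIdx P Q R S) ℂ) :
    Tendsto (fun t : ℝ => ((t : ℝ) : ℂ)⁻¹ • (hypOp R S p₀ q₀ t (binvPi F) - binvPi F)) (𝓝[≠] 0)
      (𝓝 (binvPi (I • ((∑ s : S, hypPairSymb (Sum.inr (Sum.inl (p₀, s))) (Sum.inl (Sum.inr (q₀, s))) F) -
        ∑ r : R, hypPairSymb (Sum.inl (Sum.inl (p₀, r))) (Sum.inr (Sum.inr (q₀, r))) F)))) := by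
  rw [← hypOpGen_binvPi_frame]
  exact tendsto_hypOp_sub_div_ofReal R S p₀ q₀ (binvPi F)

/-- the same slope written with `hypOp 0 (B⁻¹F)` in place of `B⁻¹F` (the shape of a difference quotient of the
family `t ↦ hypOp t` at `t = 0`). [cite: Folland1989, Prop (4.39)] -/
theorem tendsto_hypOp_binvPi_sub_hypOp_zero_div_frame (F : MvPolynomial (DPIdx P Q R S) ℂ) :
    Tendsto (fun t : ℝ => ((t : ℝ) : ℂ)⁻¹ • (hypOp R S p₀ q₀ t (binvPi F) - hypOp R S p₀ q₀ 0 (binvPi F))) (𝓝[≠] 0)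
      (𝓝 (binvPi (I • ((∑ s : S, hypPairSymb (Sum.inr (Sum.inl (p₀, s))) (Sum.inl (Sum.inr (q₀, s))) F) -
        ∑ r : R, hypPairSymb (Sum.inl (Sum.inl (p₀, r))) (Sum.inr (Sum.inr (q₀, r))) F)))) := by
  simp only [hypOp_zero, ContinuousLinearMap.id_apply]
  exact tendsto_hypOp_binvPi_sub_div_frame R S p₀ q₀ F

/-- the generic slope of §6 written with `hypOp 0 (B⁻¹F)` in place of `B⁻¹F`. [cite: Folland1989, Prop (4.39)] -/
theorem tendsto_hypOp_binvPi_sub_hypOp_zero_div_ofReal (F : MvPolynomial (DPIdx P Q R S) ℂ) :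
    Tendsto (fun t : ℝ => ((t : ℝ) : ℂ)⁻¹ • (hypOp R S p₀ q₀ t (binvPi F) - hypOp R S p₀ q₀ 0 (binvPi F))) (𝓝[≠] 0)
      (𝓝 (binvPi (linSubst ((frameU R S p₀ q₀ : Matrix.unitaryGroup (DPIdx P Q R S) ℂ) : Matrix _ _ ℂ)
        (hypFockSymb R S p₀ q₀
          (linSubst (star ((frameU R S p₀ q₀ : Matrix.unitaryGroup (DPIdx P Q R S) ℂ) : Matrix _ _ ℂ)) F))))) := by
  simp only [hypOp_zero, ContinuousLinearMap.id_apply]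
  exact tendsto_hypOp_binvPi_sub_div_ofReal R S p₀ q₀ F

end Schwartz

end RealDualPair

end Literature.RepresentationTheory.KonnoKonno2007

end
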